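import Literature.AlgebraicGeometry.Motives.CartierDivisorCocycleAction
import Literature.AlgebraicGeometry.Motives.CartierDivisorSectionAlongRestrict
import HarnessLib

/-!
# Trivialisations of `ι^*𝒪_X(D)` subordinate to a charted family of opens (Čech form)

`Motives/CartierDivisorCocycle` describes the line bundle `ι^*𝒪_X(D)` along a morphism
`ι : X' → X` (`X` integral, `D = (U_i, f_i)` a Cartier divisor, `X'` arbitrary) in the charts
`ι⁻¹U_i` of `D`: a trivialisation (`CartierDivisor.Trivialization`) is a family of units
`σ_i ∈ Γ(ι⁻¹U_i, 𝒪_{X'})` with `σ_i = ι^*(g_ij) σ_j`, `g_ij = f_i/f_j` (Görtz–Wedhorn I,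
Prop. 11.15 / Rem. 11.16). For the deformation-theoretic Step (I) of the proof of Görtz–Wedhorn II,
Lemma 24.72 one needs the same data on a REFINEMENT by smaller opens (affine pieces on which
sections can be lifted along a nilpotent thickening): this file introduces

* `CartierDivisor.ChartedCover D` — a family of opens `V_a ⊆ X` with a chart assignment
  `V_a ⊆ U_{c(a)}`, and the pulled-back cocycle `ChartedCover.trans 𝒱 φ a b = φ^*(g_{c(a)c(b)})`
  on `φ⁻¹V_a ∩ φ⁻¹V_b` (a unit satisfying the cocycle identity);
* `ChartedCover.CechTriv 𝒱 φ` — units `s_a ∈ Γ(φ⁻¹V_a, 𝒪_{X'})` with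
  `s_a = φ^*(g_{c(a)c(b)}) s_b`: a trivialisation of `φ^*𝒪_X(D)` written on the opens `φ⁻¹V_a`
  (a Čech `0`-cochain trivialising the `1`-cocycle `φ^*(g)` of the covering `(φ⁻¹V_a)`,
  Görtz–Wedhorn I, (11.6));
* `CechTriv.ofTrivialization` (restriction from the charts), `comp` / `cast` (pullback along
  `X'' → X'`), `scale` by global units, `exists_scale_eq` (two such trivialisations differ by a
  global unit when the `φ⁻¹V_a` cover `X'`), and **gluing back to the charts**
  `CechTriv.toTrivialization` (when the `φ⁻¹V_a` cover `X'`): `D.TrivialAlong φ`.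

All statements are proved (sheaf axiom for `𝒪_{X'}`: Mathlib `TopCat.Sheaf.existsUnique_gluing'`,
`TopCat.Sheaf.eq_of_locally_eq'`; units are detected on stalks,
`RingedSpace.isUnit_of_isUnit_germ`). Related: `Trivialization.reindex` of
`Motives/CartierDivisorCocycle` transports along a refinement that is itself a presentation of
`D` covering all of `X`; here the `V_a` need only cover the image of `φ`.

## References

* U. Görtz, T. Wedhorn, *Algebraic Geometry I: Schemes*, 2nd ed. (2020),
  doi:10.1007/978-3-658-30733-2: (11.5)–(11.6), Prop. 11.15 / Rem. 11.16, pp. 365–369.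
  [GortzWedhorn2020]
* U. Görtz, T. Wedhorn, *Algebraic Geometry II* (2023), doi:10.1007/978-3-658-43031-3:
  Lemma 24.72, proof, Step (I), p. 548. [GortzWedhorn2023]
-/

universe u

open CategoryTheory AlgebraicGeometry TopologicalSpace Opposite

noncomputable section

namespace Literature.AlgebraicGeometry.Motives

namespace CartierDivisor

open RatFn

variable {X : Scheme.{u}} [IsIntegral X] (D : CartierDivisor X)

/-- **A charted family of opens** for the Cartier divisor `D = (U_i, f_i)`: opens `V_a ⊆ X`
(`a : κ`) with a chart `c(a)` containing each, `V_a ⊆ U_{c(a)}` — the shape of a refinement of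
the chart covering on which `𝒪_X(D)|_{V_a} = f_{c(a)}⁻¹𝒪_{V_a}`. (No covering condition is
imposed here; it enters the gluing statements as a hypothesis on `φ⁻¹V_a`.) [folklore] -/
structure ChartedCover where
  /-- The index type. -/
  κ : Type u
  /-- The opens `V_a`. -/
  V : κ → X.Opens
  /-- The chart assigned to `a`. -/
  chart : κ → D.ι
  /-- `V_a ⊆ U_{c(a)}`. -/
  V_le : ∀ a, V a ≤ D.U (chart a)

omit [IsIntegral X] in
/-- Restricting along `V ≤ V` is the identity. [folklore] -/
theorem map_homOfLE_refl {V : X.Opens} (h : V ≤ V) (x : Γ(X, V)) :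
    X.presheaf.map (homOfLE h).op x = x := by
  have : (homOfLE h).op = 𝟙 (op V) := Subsingleton.elim _ _
  rw [this, CategoryTheory.Functor.map_id]
  rfl

/-! ### The pulled-back cocycle `φ^*(g_ij)` on opens of `X'` -/

section PullTrans

variable {D} {X' X'' : Scheme.{u}}

/-- **The pulled-back cocycle** `φ^*(g_ij)|_W ∈ Γ(W, 𝒪_{X'})` on an open `W ⊆ φ⁻¹(U_i ∩ U_j)`
(`g_ij = f_i/f_j`, `CartierDivisor.transFun`; Mathlib `Scheme.Hom.appLE`). [folklore] -/
def pullTrans (D : CartierDivisor X) (φ : X' ⟶ X) (i j : D.ι) (W : X'.Opens)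
    (h : W ≤ φ ⁻¹ᵁ (D.U i ⊓ D.U j)) : Γ(X', W) :=
  φ.appLE (D.U i ⊓ D.U j) W h (D.transFun i j)

/-- `φ^*(g_ij)|_W` is a unit. [folklore] -/
theorem isUnit_pullTrans (φ : X' ⟶ X) (i j : D.ι) (W : X'.Opens) (h : W ≤ φ ⁻¹ᵁ (D.U i ⊓ D.U j)) :
    IsUnit (D.pullTrans φ i j W h) :=
  (D.isUnit_transFun i j).map _

/-- Restricting `φ^*(g_ij)|_W` to `W' ⊆ W`. [folklore] -/
theorem map_pullTrans (φ : X' ⟶ X) (i j : D.ι) {W W' : X'.Opens} (h : W ≤ φ ⁻¹ᵁ (D.U i ⊓ D.U j))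
    (h' : W' ≤ W) :
    X'.presheaf.map (homOfLE h').op (D.pullTrans φ i j W h) = D.pullTrans φ i j W' (h'.trans h) := by
  rw [pullTrans, ← CommRingCat.comp_apply, Scheme.Hom.appLE_map]
  rfl

/-- `φ^*(g_ii) = 1`. [folklore] -/
theorem pullTrans_self (φ : X' ⟶ X) (i : D.ι) (W : X'.Opens) (h : W ≤ φ ⁻¹ᵁ (D.U i ⊓ D.U i)) :
    D.pullTrans φ i i W h = 1 := by
  rw [pullTrans, D.transFun_self, map_one]

/-- **The cocycle identity** `φ^*(g_ij) · φ^*(g_jk) = φ^*(g_ik)` on `W ⊆ φ⁻¹(U_i ∩ U_j ∩ U_k)`.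
[folklore] -/
theorem pullTrans_mul_pullTrans (φ : X' ⟶ X) (i j k : D.ι) (W : X'.Opens) (hi : W ≤ φ ⁻¹ᵁ D.U i)
    (hj : W ≤ φ ⁻¹ᵁ D.U j) (hk : W ≤ φ ⁻¹ᵁ D.U k) :
    D.pullTrans φ i j W (fun _ hx => ⟨hi hx, hj hx⟩) * D.pullTrans φ j k W (fun _ hx => ⟨hj hx, hk hx⟩) =
      D.pullTrans φ i k W (fun _ hx => ⟨hi hx, hk hx⟩) := by
  have hW : W ≤ φ ⁻¹ᵁ (D.U i ⊓ D.U j ⊓ D.U k) := fun _ hx => ⟨⟨hi hx, hj hx⟩, hk hx⟩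
  have key := congrArg (φ.appLE _ W hW) (D.transFun_mul_transFun i j k)
  rw [map_mul] at key
  simp only [← CommRingCat.comp_apply, Scheme.Hom.map_appLE] at key
  exact key

/-- `φ^*(g_ij) · φ^*(g_ji) = 1` on `W ⊆ φ⁻¹(U_i ∩ U_j)`. [folklore] -/
theorem pullTrans_mul_pullTrans_symm (φ : X' ⟶ X) (i j : D.ι) (W : X'.Opens) (hi : W ≤ φ ⁻¹ᵁ D.U i)
    (hj : W ≤ φ ⁻¹ᵁ D.U j) :
    D.pullTrans φ i j W (fun _ hx => ⟨hi hx, hj hx⟩) *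
      D.pullTrans φ j i W (fun _ hx => ⟨hj hx, hi hx⟩) = 1 := by
  rw [D.pullTrans_mul_pullTrans φ i j i W hi hj hi, pullTrans_self]

/-- The cocycle pulls back along `ψ : X'' → X'`: `ψ^*(φ^*g_ij) = (ψ ≫ φ)^*g_ij`. [folklore] -/
theorem appLE_pullTrans (φ : X' ⟶ X) (ψ : X'' ⟶ X') (i j : D.ι) (W : X'.Opens)
    (h : W ≤ φ ⁻¹ᵁ (D.U i ⊓ D.U j)) (W' : X''.Opens) (h' : W' ≤ ψ ⁻¹ᵁ W) :
    ψ.appLE W W' h' (D.pullTrans φ i j W h) =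
      D.pullTrans (ψ ≫ φ) i j W' (h'.trans (ψ.preimage_mono h)) := by
  rw [pullTrans, pullTrans, ← CommRingCat.comp_apply, Scheme.Hom.appLE_comp_appLE]

end PullTrans

namespace ChartedCover

variable {D} (𝒱 : D.ChartedCover) {X' X'' : Scheme.{u}}

/-- `φ⁻¹V_a ∩ φ⁻¹V_b ⊆ φ⁻¹(U_{c(a)} ∩ U_{c(b)})`. [folklore] -/
theorem preimage_inf_le (φ : X' ⟶ X) (a b : 𝒱.κ) :
    φ ⁻¹ᵁ 𝒱.V a ⊓ φ ⁻¹ᵁ 𝒱.V b ≤ φ ⁻¹ᵁ (D.U (𝒱.chart a) ⊓ D.U (𝒱.chart b)) :=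
  fun _ hx => ⟨𝒱.V_le a hx.1, 𝒱.V_le b hx.2⟩

/-- **The pulled-back cocycle** `φ^*(g_{c(a)c(b)}) ∈ Γ(φ⁻¹V_a ∩ φ⁻¹V_b, 𝒪_{X'})`
(`g_ij = f_i/f_j`, `CartierDivisor.transFun`). [folklore] -/
def trans (φ : X' ⟶ X) (a b : 𝒱.κ) : Γ(X', φ ⁻¹ᵁ 𝒱.V a ⊓ φ ⁻¹ᵁ 𝒱.V b) :=
  D.pullTrans φ (𝒱.chart a) (𝒱.chart b) _ (𝒱.preimage_inf_le φ a b)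

/-- The pulled-back cocycle is a unit. [folklore] -/
theorem isUnit_trans (φ : X' ⟶ X) (a b : 𝒱.κ) : IsUnit (𝒱.trans φ a b) :=
  D.isUnit_pullTrans _ _ _ _ _

/-- The pulled-back cocycle on any smaller open `W`: `φ^*(g_{c(a)c(b)})|_W`. [folklore] -/
theorem map_trans (φ : X' ⟶ X) (a b : 𝒱.κ) {W : X'.Opens} (h : W ≤ φ ⁻¹ᵁ 𝒱.V a ⊓ φ ⁻¹ᵁ 𝒱.V b) :
    X'.presheaf.map (homOfLE h).op (𝒱.trans φ a b) =
      D.pullTrans φ (𝒱.chart a) (𝒱.chart b) W (h.trans (𝒱.preimage_inf_le φ a b)) :=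
  D.map_pullTrans _ _ _ _ _

/-- `φ^*(g_{cc}) = 1`: the cocycle is trivial between two members with the same chart (in
particular on the diagonal). [folklore] -/
theorem trans_eq_one_of_chart_eq (φ : X' ⟶ X) {a b : 𝒱.κ} (h : 𝒱.chart a = 𝒱.chart b) :
    𝒱.trans φ a b = 1 := by
  have e : D.transFun (𝒱.chart a) (𝒱.chart b) = 1 := by
    rw [h]; exact D.transFun_self _
  rw [trans, pullTrans, e, map_one]

/-- **The cocycle identity** `φ^*(g_{c(a)c(b)}) · φ^*(g_{c(b)c(d)}) = φ^*(g_{c(a)c(d)})` on any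
`W ⊆ φ⁻¹V_a ∩ φ⁻¹V_b ∩ φ⁻¹V_d`. [folklore] -/
theorem trans_mul_trans (φ : X' ⟶ X) (a b d : 𝒱.κ) {W : X'.Opens} (ha : W ≤ φ ⁻¹ᵁ 𝒱.V a)
    (hb : W ≤ φ ⁻¹ᵁ 𝒱.V b) (hd : W ≤ φ ⁻¹ᵁ 𝒱.V d) :
    X'.presheaf.map (homOfLE (le_inf ha hb)).op (𝒱.trans φ a b) *
        X'.presheaf.map (homOfLE (le_inf hb hd)).op (𝒱.trans φ b d) =
      X'.presheaf.map (homOfLE (le_inf ha hd)).op (𝒱.trans φ a d) := by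
  rw [map_trans, map_trans, map_trans]
  exact D.pullTrans_mul_pullTrans φ _ _ _ W (fun x hx => 𝒱.V_le a (ha hx))
    (fun x hx => 𝒱.V_le b (hb hx)) (fun x hx => 𝒱.V_le d (hd hx))

/-- `φ^*(g_{c(a)c(b)}) · φ^*(g_{c(b)c(a)}) = 1` on any `W ⊆ φ⁻¹V_a ∩ φ⁻¹V_b`. [folklore] -/
theorem trans_mul_trans_symm (φ : X' ⟶ X) (a b : 𝒱.κ) {W : X'.Opens} (ha : W ≤ φ ⁻¹ᵁ 𝒱.V a)
    (hb : W ≤ φ ⁻¹ᵁ 𝒱.V b) :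
    X'.presheaf.map (homOfLE (le_inf ha hb)).op (𝒱.trans φ a b) *
        X'.presheaf.map (homOfLE (le_inf hb ha)).op (𝒱.trans φ b a) = 1 := by
  rw [𝒱.trans_mul_trans φ a b a ha hb ha, 𝒱.trans_eq_one_of_chart_eq φ rfl, map_one]

/-- The cocycle pulls back along `ψ : X'' → X'`: `ψ^*(φ^*g) = (ψ ≫ φ)^*g`. [folklore] -/
theorem appLE_trans (φ : X' ⟶ X) (ψ : X'' ⟶ X') (a b : 𝒱.κ) {W : X''.Opens}
    (h : W ≤ ψ ⁻¹ᵁ (φ ⁻¹ᵁ 𝒱.V a ⊓ φ ⁻¹ᵁ 𝒱.V b)) :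
    ψ.appLE _ W h (𝒱.trans φ a b) =
      X''.presheaf.map (homOfLE (show W ≤ (ψ ≫ φ) ⁻¹ᵁ 𝒱.V a ⊓ (ψ ≫ φ) ⁻¹ᵁ 𝒱.V b from h)).op
        (𝒱.trans (ψ ≫ φ) a b) := by
  rw [map_trans, trans, D.appLE_pullTrans]

/-- `φ^*(g_{i c(a)})` on `φ⁻¹U_i ∩ φ⁻¹V_a` times `φ^*(g_{c(a)c(b)})` is `φ^*(g_{i c(b)})`, on any
`W` inside all three preimages (mixed form of the cocycle identity used for gluing). [folklore] -/
theorem pullTrans_mul_trans (φ : X' ⟶ X) (i : D.ι) (a b : 𝒱.κ) {W : X'.Opens}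
    (hi : W ≤ φ ⁻¹ᵁ D.U i) (ha : W ≤ φ ⁻¹ᵁ 𝒱.V a) (hb : W ≤ φ ⁻¹ᵁ 𝒱.V b) :
    D.pullTrans φ i (𝒱.chart a) W (fun _ hx => ⟨hi hx, 𝒱.V_le a (ha hx)⟩) *
        X'.presheaf.map (homOfLE (le_inf ha hb)).op (𝒱.trans φ a b) =
      D.pullTrans φ i (𝒱.chart b) W (fun _ hx => ⟨hi hx, 𝒱.V_le b (hb hx)⟩) := by
  rw [map_trans]
  exact D.pullTrans_mul_pullTrans φ _ _ _ W hi (fun x hx => 𝒱.V_le a (ha hx))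
    (fun x hx => 𝒱.V_le b (hb hx))

/-! ### Čech trivialisations subordinate to `𝒱` -/

/-- **A trivialisation of `φ^*𝒪_X(D)` on the opens `φ⁻¹V_a`**: units
`s_a ∈ Γ(φ⁻¹V_a, 𝒪_{X'})` with `s_a = φ^*(g_{c(a)c(b)}) s_b` on `φ⁻¹V_a ∩ φ⁻¹V_b` — the
coordinates, in the trivialisations `𝒪_{V_a} ⥲ 𝒪_X(D)|_{V_a}`, `1 ↦ f_{c(a)}⁻¹`, of a
nowhere-vanishing section of `φ^*𝒪_X(D)` over `⋃_a φ⁻¹V_a` (Görtz–Wedhorn I, (11.6),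
Prop. 11.15). [cite: GortzWedhorn2020, Prop. 11.15 and Rem. 11.16 (pp. 368–369)] -/
structure CechTriv (φ : X' ⟶ X) where
  /-- The coordinate `s_a` on `φ⁻¹V_a`. -/
  s : ∀ a : 𝒱.κ, Γ(X', φ ⁻¹ᵁ 𝒱.V a)
  /-- Each `s_a` is a unit. -/
  isUnit : ∀ a, IsUnit (s a)
  /-- `s_a = φ^*(g_{c(a)c(b)}) s_b` on `φ⁻¹V_a ∩ φ⁻¹V_b`. -/
  cocycle : ∀ a b, X'.presheaf.map (homOfLE inf_le_left).op (s a) =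
    𝒱.trans φ a b * X'.presheaf.map (homOfLE inf_le_right).op (s b)

namespace CechTriv

variable {𝒱} {φ : X' ⟶ X}

/-- Two Čech trivialisations with the same coordinates are equal. [folklore] -/
@[ext] theorem ext {t t' : 𝒱.CechTriv φ} (h : ∀ a, t.s a = t'.s a) : t = t' := by
  cases t; cases t'; congr; exact funext h

/-- The cocycle relation on any `W ⊆ φ⁻¹V_a ∩ φ⁻¹V_b`. [folklore] -/
theorem cocycle_res (t : 𝒱.CechTriv φ) (a b : 𝒱.κ) {W : X'.Opens} (ha : W ≤ φ ⁻¹ᵁ 𝒱.V a)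
    (hb : W ≤ φ ⁻¹ᵁ 𝒱.V b) :
    X'.presheaf.map (homOfLE ha).op (t.s a) =
      X'.presheaf.map (homOfLE (le_inf ha hb)).op (𝒱.trans φ a b) *
        X'.presheaf.map (homOfLE hb).op (t.s b) := by
  have h := congrArg (X'.presheaf.map (homOfLE (le_inf ha hb :
    W ≤ φ ⁻¹ᵁ 𝒱.V a ⊓ φ ⁻¹ᵁ 𝒱.V b)).op) (t.cocycle a b)
  rw [map_mul, res_res, res_res] at h
  exact h

/-! #### From a trivialisation in the charts -/

variable (𝒱) in
/-- **Restriction of a trivialisation of `φ^*𝒪_X(D)` to the opens `φ⁻¹V_a ⊆ φ⁻¹U_{c(a)}`.**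
[folklore] -/
def ofTrivialization (τ : D.Trivialization φ) : 𝒱.CechTriv φ where
  s a := X'.presheaf.map (homOfLE (φ.preimage_mono (𝒱.V_le a))).op (τ.σ (𝒱.chart a))
  isUnit a := (τ.isUnit _).map _
  cocycle a b := by
    have h := congrArg (X'.presheaf.map (homOfLE (show φ ⁻¹ᵁ 𝒱.V a ⊓ φ ⁻¹ᵁ 𝒱.V b ≤
      φ ⁻¹ᵁ D.U (𝒱.chart a) ⊓ φ ⁻¹ᵁ D.U (𝒱.chart b) from
        fun _ hx => ⟨𝒱.V_le a hx.1, 𝒱.V_le b hx.2⟩)).op) (τ.cocycle (𝒱.chart a) (𝒱.chart b))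
    rw [map_mul, res_res, res_res, ← CommRingCat.comp_apply, Scheme.Hom.appLE_map] at h
    rw [res_res, res_res]
    exact h

/-- The coordinates of `ofTrivialization`. [folklore] -/
@[simp] theorem ofTrivialization_s (τ : D.Trivialization φ) (a : 𝒱.κ) :
    (ofTrivialization 𝒱 τ).s a =
      X'.presheaf.map (homOfLE (φ.preimage_mono (𝒱.V_le a))).op (τ.σ (𝒱.chart a)) := rfl

/-! #### Pullback along `X'' → X'` -/

/-- **Pullback of a Čech trivialisation** along `ψ : X'' → X'`: `(ψ^*s)_a = ψ^*(s_a)`.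
[folklore] -/
def comp (t : 𝒱.CechTriv φ) (ψ : X'' ⟶ X') : 𝒱.CechTriv (ψ ≫ φ) where
  s a := ψ.appLE (φ ⁻¹ᵁ 𝒱.V a) ((ψ ≫ φ) ⁻¹ᵁ 𝒱.V a) le_rfl (t.s a)
  isUnit a := (t.isUnit a).map _
  cocycle a b := by
    have h := congrArg (ψ.appLE (φ ⁻¹ᵁ 𝒱.V a ⊓ φ ⁻¹ᵁ 𝒱.V b)
      ((ψ ≫ φ) ⁻¹ᵁ 𝒱.V a ⊓ (ψ ≫ φ) ⁻¹ᵁ 𝒱.V b) le_rfl) (t.cocycle a b)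
    rw [map_mul, 𝒱.appLE_trans] at h
    rw [← CommRingCat.comp_apply, ← CommRingCat.comp_apply, Scheme.Hom.appLE_map,
      Scheme.Hom.appLE_map]
    rw [← CommRingCat.comp_apply, ← CommRingCat.comp_apply, Scheme.Hom.map_appLE,
      Scheme.Hom.map_appLE, map_homOfLE_refl] at h
    exact h

/-- The coordinates of a pulled-back Čech trivialisation. [folklore] -/
@[simp] theorem comp_s (t : 𝒱.CechTriv φ) (ψ : X'' ⟶ X') (a : 𝒱.κ) :
    (t.comp ψ).s a = ψ.appLE (φ ⁻¹ᵁ 𝒱.V a) ((ψ ≫ φ) ⁻¹ᵁ 𝒱.V a) le_rfl (t.s a) := rfl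

/-- **Transport along an equality of structure morphisms** `φ = φ'`. [folklore] -/
def cast {φ' : X' ⟶ X} (e : φ = φ') (t : 𝒱.CechTriv φ) : 𝒱.CechTriv φ' := e ▸ t

/-- The coordinates of a transported Čech trivialisation. [folklore] -/
theorem cast_s {φ' : X' ⟶ X} (e : φ = φ') (t : 𝒱.CechTriv φ) (a : 𝒱.κ) :
    (t.cast e).s a = X'.presheaf.map (eqToHom (by rw [e])).op (t.s a) := by
  subst e
  simp [cast]

/-- **Restriction along a morphism over `X`** (`ψ ≫ φ = φ'`): pullback followed by transport.
[folklore] -/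
def restrict (t : 𝒱.CechTriv φ) (ψ : X'' ⟶ X') {φ' : X'' ⟶ X} (e : ψ ≫ φ = φ') :
    𝒱.CechTriv φ' :=
  (t.comp ψ).cast e

/-- The coordinates of a restricted Čech trivialisation. [folklore] -/
theorem restrict_s (t : 𝒱.CechTriv φ) (ψ : X'' ⟶ X') {φ' : X'' ⟶ X} (e : ψ ≫ φ = φ')
    (a : 𝒱.κ) : (t.restrict ψ e).s a =
      ψ.appLE (φ ⁻¹ᵁ 𝒱.V a) (φ' ⁻¹ᵁ 𝒱.V a) (by rw [← e]; exact le_rfl) (t.s a) := by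
  subst e
  rfl

/-- `ofTrivialization` commutes with restriction. [folklore] -/
theorem ofTrivialization_restrict (τ : D.Trivialization φ) (ψ : X'' ⟶ X') {φ' : X'' ⟶ X}
    (e : ψ ≫ φ = φ') :
    (ofTrivialization 𝒱 τ).restrict ψ e = ofTrivialization 𝒱 (τ.restrict ψ e) := by
  subst e
  ext a
  rw [restrict_s, ofTrivialization_s, ofTrivialization_s, Trivialization.restrict_toSectionAlong,
    SectionAlong.restrict_σ, ← CommRingCat.comp_apply, ← CommRingCat.comp_apply,
    Scheme.Hom.appLE_map, Scheme.Hom.map_appLE]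

/-! #### Scaling by global units -/

/-- **Scaling a Čech trivialisation by a global unit** `u ∈ Γ(X', 𝒪)^×`: `(u · s)_a = u| s_a`.
[folklore] -/
def scale (u : Γ(X', ⊤)ˣ) (t : 𝒱.CechTriv φ) : 𝒱.CechTriv φ where
  s a := resTo X' _ (u : Γ(X', ⊤)) * t.s a
  isUnit a := (u.isUnit.map _).mul (t.isUnit a)
  cocycle a b := by
    rw [map_mul, map_mul, map_resTo, map_resTo, t.cocycle a b]
    ring

/-- The coordinates of a scaled Čech trivialisation. [folklore] -/
@[simp] theorem scale_s (u : Γ(X', ⊤)ˣ) (t : 𝒱.CechTriv φ) (a : 𝒱.κ) :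
    (t.scale u).s a = resTo X' _ (u : Γ(X', ⊤)) * t.s a := rfl

/-- `ofTrivialization` commutes with scaling. [folklore] -/
theorem ofTrivialization_scale (u : Γ(X', ⊤)ˣ) (τ : D.Trivialization φ) :
    ofTrivialization 𝒱 (τ.scale u) = (ofTrivialization 𝒱 τ).scale u := by
  ext a
  rw [scale_s, ofTrivialization_s, ofTrivialization_s, Trivialization.scale_σ, map_mul, map_resTo]

/-- Scaling commutes with restriction: `ψ^*(u · s) = ψ^*(u) · ψ^*(s)`. [folklore] -/
theorem restrict_scale (u : Γ(X', ⊤)ˣ) (t : 𝒱.CechTriv φ) (ψ : X'' ⟶ X') {φ' : X'' ⟶ X}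
    (e : ψ ≫ φ = φ') :
    (t.scale u).restrict ψ e =
      (t.restrict ψ e).scale (Units.map ψ.appTop.hom.toMonoidHom u) := by
  subst e
  ext a
  rw [restrict_s, scale_s, scale_s, restrict_s, map_mul]
  congr 1
  rw [Units.coe_map, RingHom.toMonoidHom_eq_coe, MonoidHom.coe_coe, SectionAlong.resTo_appTop]
  change (X'.presheaf.map (homOfLE le_top).op ≫ ψ.appLE (φ ⁻¹ᵁ 𝒱.V a) ((ψ ≫ φ) ⁻¹ᵁ 𝒱.V a)
    le_rfl) (u : Γ(X', ⊤)) = _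
  rw [Scheme.Hom.map_appLE]

/-! #### Two Čech trivialisations differ by a global unit -/

/-- **Two Čech trivialisations of `φ^*𝒪_X(D)` on a family `φ⁻¹V_a` covering `X'` differ by a
global unit** `u ∈ Γ(X', 𝒪)^×`, `t' = u · t`: the ratios `s'_a/s_a` agree on overlaps (the cocycle
cancels) and glue (Görtz–Wedhorn I, (11.6): trivialisations form an `𝒪^×`-torsor; cf.
`Trivialization.exists_unique_scale_eq`). [folklore] -/
theorem exists_scale_eq (hcov : (⊤ : X'.Opens) ≤ ⨆ a, φ ⁻¹ᵁ 𝒱.V a) (t t' : 𝒱.CechTriv φ) :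
    ∃ u : Γ(X', ⊤)ˣ, t' = t.scale u := by
  -- the local ratios `r a = s'_a / s_a`
  have hr : ∀ a, ∃ r : Γ(X', φ ⁻¹ᵁ 𝒱.V a), t'.s a = r * t.s a := fun a => by
    obtain ⟨v, hv⟩ := t.isUnit a
    exact ⟨t'.s a * ↑v⁻¹, by rw [mul_assoc, ← hv, Units.inv_mul, mul_one]⟩
  choose r hr using hr
  -- they are compatible on overlaps
  have hcompat : TopCat.Presheaf.IsCompatible X'.presheaf (fun a => φ ⁻¹ᵁ 𝒱.V a) r := by
    intro a b
    have ha := congrArg (X'.presheaf.map (homOfLE (inf_le_left :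
      φ ⁻¹ᵁ 𝒱.V a ⊓ φ ⁻¹ᵁ 𝒱.V b ≤ _)).op) (hr a)
    have hb := congrArg (X'.presheaf.map (homOfLE (inf_le_right :
      φ ⁻¹ᵁ 𝒱.V a ⊓ φ ⁻¹ᵁ 𝒱.V b ≤ _)).op) (hr b)
    rw [map_mul] at ha hb
    rw [t'.cocycle a b, t.cocycle a b, hb] at ha
    have hu : IsUnit (𝒱.trans φ a b * X'.presheaf.map (homOfLE inf_le_right).op (t.s b)) :=
      (𝒱.isUnit_trans φ a b).mul ((t.isUnit b).map _)
    have h2 : (𝒱.trans φ a b * X'.presheaf.map (homOfLE inf_le_right).op (t.s b)) *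
        X'.presheaf.map (homOfLE inf_le_right).op (r b) =
      (𝒱.trans φ a b * X'.presheaf.map (homOfLE inf_le_right).op (t.s b)) *
        X'.presheaf.map (homOfLE inf_le_left).op (r a) := by
      rw [mul_comm _ (X'.presheaf.map (homOfLE inf_le_left).op (r a)), ← ha]
      ring
    exact (hu.mul_right_inj.1 h2).symm
  -- glue
  obtain ⟨u, hu, -⟩ : ∃! u : Γ(X', ⊤), ∀ a, X'.presheaf.map (homOfLE le_top).op u = r a :=
    X'.sheaf.existsUnique_gluing' (fun a => φ ⁻¹ᵁ 𝒱.V a) ⊤ (fun a => homOfLE le_top) hcov r hcompat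
  -- `u` is a unit: locally it is the unit `r a`
  have hru : ∀ a, IsUnit (r a) := fun a => by
    obtain ⟨v', hv'⟩ := t'.isUnit a
    obtain ⟨v, hv⟩ := t.isUnit a
    have h1 : (v' : Γ(X', φ ⁻¹ᵁ 𝒱.V a)) = r a * v := by rw [hv', hv]; exact hr a
    have h3 : r a = v' * ↑v⁻¹ := by rw [h1, mul_assoc, Units.mul_inv, mul_one]
    rw [h3]
    exact v'.isUnit.mul (v⁻¹).isUnit
  have huu : IsUnit u := by
    refine RingedSpace.isUnit_of_isUnit_germ (X := X'.toLocallyRingedSpace.toRingedSpace) ⊤ u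
      fun x _ => ?_
    obtain ⟨a, ha⟩ := Opens.mem_iSup.1 (hcov (Set.mem_univ x))
    have hgerm : X'.presheaf.germ ⊤ x trivial u = X'.presheaf.germ (φ ⁻¹ᵁ 𝒱.V a) x ha (r a) := by
      rw [← hu a]
      exact (TopCat.Presheaf.germ_res_apply X'.presheaf (homOfLE le_top) x ha u).symm
    rw [hgerm]
    exact (hru a).map _
  refine ⟨huu.unit, ?_⟩
  ext a
  rw [scale_s, IsUnit.unit_spec, hr a]
  congr 1
  exact (hu a).symm

/-! #### Gluing back to the charts -/

/-- The gluing pieces `φ^*(g_{i c(a)}) · s_a` on `φ⁻¹U_i ∩ φ⁻¹V_a`. [folklore] -/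
def piece (t : 𝒱.CechTriv φ) (i : D.ι) (a : 𝒱.κ) : Γ(X', φ ⁻¹ᵁ D.U i ⊓ φ ⁻¹ᵁ 𝒱.V a) :=
  D.pullTrans φ i (𝒱.chart a) (φ ⁻¹ᵁ D.U i ⊓ φ ⁻¹ᵁ 𝒱.V a) (fun _ hx => ⟨hx.1, 𝒱.V_le a hx.2⟩) *
    X'.presheaf.map (homOfLE inf_le_right).op (t.s a)

/-- The pieces restricted to any `W ⊆ φ⁻¹U_i ∩ φ⁻¹V_a`. [folklore] -/
theorem map_piece (t : 𝒱.CechTriv φ) (i : D.ι) (a : 𝒱.κ) {W : X'.Opens} (hi : W ≤ φ ⁻¹ᵁ D.U i)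
    (ha : W ≤ φ ⁻¹ᵁ 𝒱.V a) :
    X'.presheaf.map (homOfLE (le_inf hi ha)).op (t.piece i a) =
      D.pullTrans φ i (𝒱.chart a) W (fun _ hx => ⟨hi hx, 𝒱.V_le a (ha hx)⟩) *
        X'.presheaf.map (homOfLE ha).op (t.s a) := by
  rw [piece, map_mul, D.map_pullTrans, res_res]

/-- The pieces are units. [folklore] -/
theorem isUnit_piece (t : 𝒱.CechTriv φ) (i : D.ι) (a : 𝒱.κ) : IsUnit (t.piece i a) :=
  (D.isUnit_pullTrans _ _ _ _ _).mul ((t.isUnit a).map _)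

/-- The pieces are compatible on overlaps: `g_{i c(a)} s_a = g_{i c(b)} s_b` on
`φ⁻¹U_i ∩ φ⁻¹V_a ∩ φ⁻¹V_b`. [folklore] -/
theorem piece_compatible (t : 𝒱.CechTriv φ) (i : D.ι) :
    TopCat.Presheaf.IsCompatible X'.presheaf (fun a => φ ⁻¹ᵁ D.U i ⊓ φ ⁻¹ᵁ 𝒱.V a) (t.piece i) := by
  intro a b
  have hi : (φ ⁻¹ᵁ D.U i ⊓ φ ⁻¹ᵁ 𝒱.V a) ⊓ (φ ⁻¹ᵁ D.U i ⊓ φ ⁻¹ᵁ 𝒱.V b) ≤ φ ⁻¹ᵁ D.U i :=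
    inf_le_left.trans inf_le_left
  have ha : (φ ⁻¹ᵁ D.U i ⊓ φ ⁻¹ᵁ 𝒱.V a) ⊓ (φ ⁻¹ᵁ D.U i ⊓ φ ⁻¹ᵁ 𝒱.V b) ≤ φ ⁻¹ᵁ 𝒱.V a :=
    inf_le_left.trans inf_le_right
  have hb : (φ ⁻¹ᵁ D.U i ⊓ φ ⁻¹ᵁ 𝒱.V a) ⊓ (φ ⁻¹ᵁ D.U i ⊓ φ ⁻¹ᵁ 𝒱.V b) ≤ φ ⁻¹ᵁ 𝒱.V b :=
    inf_le_right.trans inf_le_right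
  change X'.presheaf.map (homOfLE (le_inf hi ha)).op (t.piece i a) =
    X'.presheaf.map (homOfLE (le_inf hi hb)).op (t.piece i b)
  rw [t.map_piece i a hi ha, t.map_piece i b hi hb, t.cocycle_res a b ha hb, ← mul_assoc,
    𝒱.pullTrans_mul_trans φ i a b hi ha hb]

/-- **Gluing a Čech trivialisation back to the charts**: if the `φ⁻¹V_a` cover `X'`, a Čech
trivialisation `(s_a)` on them comes from a unique-up-to-nothing trivialisation of `φ^*𝒪_X(D)` in
the charts `φ⁻¹U_i` — glue the sections `φ^*(g_{i c(a)}) s_a` over `a` (sheaf axiom for `𝒪_{X'}`)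
— whose restriction to the `φ⁻¹V_a` is `(s_a)` again. In particular `D.TrivialAlong φ`.
[cite: GortzWedhorn2020, Prop. 11.15 and Rem. 11.16 (pp. 368–369)] -/
theorem exists_ofTrivialization_eq (hcov : (⊤ : X'.Opens) ≤ ⨆ a, φ ⁻¹ᵁ 𝒱.V a)
    (t : 𝒱.CechTriv φ) : ∃ τ : D.Trivialization φ, ofTrivialization 𝒱 τ = t := by
  have hcovi : ∀ i : D.ι, φ ⁻¹ᵁ D.U i ≤ ⨆ a, φ ⁻¹ᵁ D.U i ⊓ φ ⁻¹ᵁ 𝒱.V a := fun i x hx => by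
    obtain ⟨a, ha⟩ := Opens.mem_iSup.1 (hcov (Set.mem_univ x))
    exact Opens.mem_iSup.2 ⟨a, hx, ha⟩
  -- glue the pieces over each chart
  have hglue : ∀ i : D.ι, ∃ σ : Γ(X', φ ⁻¹ᵁ D.U i),
      ∀ a, X'.presheaf.map (homOfLE inf_le_left).op σ = t.piece i a := fun i => by
    obtain ⟨σ, hσ, -⟩ := X'.sheaf.existsUnique_gluing' (fun a => φ ⁻¹ᵁ D.U i ⊓ φ ⁻¹ᵁ 𝒱.V a)
      (φ ⁻¹ᵁ D.U i) (fun a => homOfLE inf_le_left) (hcovi i) (t.piece i) (t.piece_compatible i)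
    exact ⟨σ, hσ⟩
  choose σ hσ using hglue
  -- the value of `σ_i` on any `W ⊆ φ⁻¹U_i ∩ φ⁻¹V_a`
  have hσW : ∀ (i : D.ι) (a : 𝒱.κ) {W : X'.Opens} (hi : W ≤ φ ⁻¹ᵁ D.U i) (ha : W ≤ φ ⁻¹ᵁ 𝒱.V a),
      X'.presheaf.map (homOfLE hi).op (σ i) =
        D.pullTrans φ i (𝒱.chart a) W (fun _ hx => ⟨hi hx, 𝒱.V_le a (ha hx)⟩) *
          X'.presheaf.map (homOfLE ha).op (t.s a) := by
    intro i a W hi ha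
    rw [← t.map_piece i a hi ha, ← hσ i a, res_res]
  -- the glued sections form a trivialisation
  have hunit : ∀ i, IsUnit (σ i) := fun i => by
    refine RingedSpace.isUnit_of_isUnit_germ (X := X'.toLocallyRingedSpace.toRingedSpace) _ (σ i)
      fun x hx => ?_
    obtain ⟨a, ha⟩ := Opens.mem_iSup.1 (hcov (Set.mem_univ x))
    have hgerm : X'.presheaf.germ (φ ⁻¹ᵁ D.U i) x hx (σ i) =
        X'.presheaf.germ (φ ⁻¹ᵁ D.U i ⊓ φ ⁻¹ᵁ 𝒱.V a) x ⟨hx, ha⟩ (t.piece i a) := by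
      rw [← hσ i a]
      exact (TopCat.Presheaf.germ_res_apply X'.presheaf (homOfLE inf_le_left) x ⟨hx, ha⟩ (σ i)).symm
    rw [hgerm]
    exact (t.isUnit_piece i a).map _
  have hcoc : ∀ i j, X'.presheaf.map (homOfLE inf_le_left).op (σ i) =
      φ.appLE (D.U i ⊓ D.U j) (φ ⁻¹ᵁ D.U i ⊓ φ ⁻¹ᵁ D.U j) (D.preimage_inf_le φ i j)
          (D.transFun i j) * X'.presheaf.map (homOfLE inf_le_right).op (σ j) := by
    intro i j
    apply X'.sheaf.eq_of_locally_eq' (fun a => φ ⁻¹ᵁ D.U i ⊓ φ ⁻¹ᵁ D.U j ⊓ φ ⁻¹ᵁ 𝒱.V a)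
      (φ ⁻¹ᵁ D.U i ⊓ φ ⁻¹ᵁ D.U j) (fun a => homOfLE inf_le_left)
    · intro x hx
      obtain ⟨a, ha⟩ := Opens.mem_iSup.1 (hcov (Set.mem_univ x))
      exact Opens.mem_iSup.2 ⟨a, hx, ha⟩
    · intro a
      have hi : φ ⁻¹ᵁ D.U i ⊓ φ ⁻¹ᵁ D.U j ⊓ φ ⁻¹ᵁ 𝒱.V a ≤ φ ⁻¹ᵁ D.U i :=
        inf_le_left.trans inf_le_left
      have hj : φ ⁻¹ᵁ D.U i ⊓ φ ⁻¹ᵁ D.U j ⊓ φ ⁻¹ᵁ 𝒱.V a ≤ φ ⁻¹ᵁ D.U j :=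
        inf_le_left.trans inf_le_right
      have ha : φ ⁻¹ᵁ D.U i ⊓ φ ⁻¹ᵁ D.U j ⊓ φ ⁻¹ᵁ 𝒱.V a ≤ φ ⁻¹ᵁ 𝒱.V a := inf_le_right
      change X'.presheaf.map (homOfLE inf_le_left).op (X'.presheaf.map _ (σ i)) =
        X'.presheaf.map (homOfLE inf_le_left).op (_ * X'.presheaf.map _ (σ j))
      rw [map_mul, res_res, res_res, hσW i a hi ha, hσW j a hj ha, ← mul_assoc]
      congr 1
      rw [← CommRingCat.comp_apply, Scheme.Hom.appLE_map]
      exact (D.pullTrans_mul_pullTrans φ i j (𝒱.chart a) _ hi hj (fun _ hx => 𝒱.V_le a (ha hx))).symm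
  refine ⟨⟨⟨σ, hcoc⟩, hunit⟩, ?_⟩
  -- its restriction to the `φ⁻¹V_a` is `t`
  ext a
  rw [ofTrivialization_s]
  change X'.presheaf.map _ (σ (𝒱.chart a)) = t.s a
  rw [hσW (𝒱.chart a) a (φ.preimage_mono (𝒱.V_le a)) le_rfl, map_homOfLE_refl]
  have h1 : D.pullTrans φ (𝒱.chart a) (𝒱.chart a) (φ ⁻¹ᵁ 𝒱.V a)
      (fun _ hx => ⟨𝒱.V_le a hx, 𝒱.V_le a hx⟩) = 1 := D.pullTrans_self _ _ _ _
  rw [h1, one_mul]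

/-- **A Čech trivialisation on a family covering `X'` trivialises `φ^*𝒪_X(D)`.** [folklore] -/
theorem trivialAlong (hcov : (⊤ : X'.Opens) ≤ ⨆ a, φ ⁻¹ᵁ 𝒱.V a) (t : 𝒱.CechTriv φ) :
    D.TrivialAlong φ := by
  obtain ⟨τ, -⟩ := t.exists_ofTrivialization_eq hcov
  exact ⟨τ⟩

end CechTriv

end ChartedCover

end CartierDivisor

end Literature.AlgebraicGeometry.Motives

end
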